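import Literature.Analysis.FluidPDE.ElgindiAngularCorrectorODE
import Mathlib.Analysis.Calculus.ContDiff.Deriv
import Mathlib.Analysis.SpecialFunctions.Pow.Deriv
import HarnessLib

/-!
# The angular corrector of Elgindi's profile: smoothness in the open quarter and the vanishing at
the boundary ([Elgindi2021] §8.3 Proposition 8.13, "Clearly `Φ̃` is infinitely differentiable away
from `θ = 0` and `θ = π/2`")

Topic `Literature/Analysis/FluidPDE`. Support file (everything proved, no definitions, no named
facts) on the proof path of the named fact
`Literature.Analysis.FluidPDE.Elgindi.ElgindiGhoulMasmoudi2021_stabilityCore`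
(`ElgindiStabilityDecomposition.lean`). T. M. Elgindi, Ann. of Math. 194 (2021) =
arXiv:1904.04795, §8.3 Proposition 8.13 (p. 27).

For the corrector `χ₁`, `ψ₁ = cos θ·χ₁` of `ElgindiAngularCorrector.lean` (`0 < α ≤ 1/200`):
* `χ₁, χ₁′, ψ₁ ∈ C^∞(0, π/2)` (`contDiffOn_chiOne`, `contDiffOn_chiOneD`, `contDiffOn_psiOne`): the
  kernel functions `k₂, v₂, u₂` and `Γ, Γ̄` are smooth in the open quarter, the primitives gain one
  derivative, and the fixed-point equation `χ₁ = 𝒦(Γ̄ − μ₁cos θχ₁) − c₁sin θ` bootstraps;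
* the vanishing at `θ = 0`: `|χ₁(θ)| ≤ 300θ` (mean value theorem from `χ₁(0) = 0`, `|χ₁′| ≤ 300`),
  `|χ₁/sin θ| ≤ 480` and `|ψ₁| ≤ 240 sin 2θ` on `(0, π/2)`.
-/

noncomputable section

open Set Real Filter MeasureTheory intervalIntegral BoundedContinuousFunction
open _root_.Topology
open scoped ContDiff

namespace Literature.Analysis.FluidPDE

namespace Elgindi

/-! ### Smoothness of the kernel functions in the open interval -/

/-- `L = log((1 + sin θ)/cos θ)` is smooth on `(−π/2, π/2)`. [folklore] -/
theorem contDiffOn_secTanLog : ContDiffOn ℝ ∞ secTanLog (Ioo (-(π / 2)) (π / 2)) := by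
  have hf : ContDiffOn ℝ ∞ (fun θ => (1 + Real.sin θ) / Real.cos θ) (Ioo (-(π / 2)) (π / 2)) :=
    ContDiffOn.div (by fun_prop) (by fun_prop) fun θ hθ => (Real.cos_pos_of_mem_Ioo hθ).ne'
  unfold secTanLog
  exact hf.log fun θ hθ => (secTanLog_arg_pos hθ).ne'

/-- `k₂` is smooth on `(−π/2, π/2)`. [folklore] -/
theorem contDiffOn_greenK2_Ioo : ContDiffOn ℝ ∞ greenK2 (Ioo (-(π / 2)) (π / 2)) := by
  have hL := contDiffOn_secTanLog
  have h : ContDiffOn ℝ ∞ (fun θ => Real.sin θ ^ 2 / 2 + 3 / 2 * Real.sin θ * Real.cos θ ^ 2 * secTanLog θ - Real.cos θ ^ 2)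
      (Ioo (-(π / 2)) (π / 2)) :=
    ((ContDiffOn.div_const (by fun_prop) 2).add ((by fun_prop : ContDiffOn ℝ ∞ (fun θ => 3 / 2 * Real.sin θ * Real.cos θ ^ 2) _).mul hL)).sub (by fun_prop)
  exact h.congr fun θ _ => rfl

/-- `v₂` is smooth on `(−π/2, π/2)`. [folklore] -/
theorem contDiffOn_greenV2_Ioo : ContDiffOn ℝ ∞ greenV2 (Ioo (-(π / 2)) (π / 2)) := by
  have hL := contDiffOn_secTanLog
  have h : ContDiffOn ℝ ∞ (fun θ => Real.sin θ + 3 / 2 * Real.cos θ ^ 4 * secTanLog θ + 3 / 2 * Real.sin θ * Real.cos θ ^ 2)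
      (Ioo (-(π / 2)) (π / 2)) :=
    ((by fun_prop : ContDiffOn ℝ ∞ (fun θ => Real.sin θ) _).add ((by fun_prop : ContDiffOn ℝ ∞ (fun θ => 3 / 2 * Real.cos θ ^ 4) _).mul hL)).add (by fun_prop)
  exact h.congr fun θ _ => rfl

/-- `u₂` is smooth on `(−π/2, π/2)`. [folklore] -/
theorem contDiffOn_greenU2_Ioo : ContDiffOn ℝ ∞ greenU2 (Ioo (-(π / 2)) (π / 2)) := by
  unfold greenU2
  exact contDiffOn_greenK2_Ioo.div (by fun_prop) fun θ hθ => pow_ne_zero 2 (Real.cos_pos_of_mem_Ioo hθ).ne'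

/-- `Γ_α = (sin θ cos²θ)^{α/3}` is smooth in the open quarter (any real `α`). [folklore] -/
theorem contDiffOn_angularWeight_Ioo (α : ℝ) : ContDiffOn ℝ ∞ (angularWeight α) (Ioo 0 (π / 2)) := by
  have hb : ContDiffOn ℝ ∞ (fun θ => Real.sin θ * Real.cos θ ^ 2) (Ioo 0 (π / 2)) := by fun_prop
  have h := hb.rpow_const_of_ne (p := α / 3) fun θ hθ => by
    have hs : 0 < Real.sin θ := Real.sin_pos_of_pos_of_lt_pi hθ.1 (by linarith [hθ.2, Real.pi_pos])
    have hc : 0 < Real.cos θ := Real.cos_pos_of_mem_Ioo ⟨by linarith [hθ.1, Real.pi_pos], hθ.2⟩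
    positivity
  exact h.congr fun θ _ => rfl

/-- `Γ̄` is smooth in the open quarter. [folklore] -/
theorem contDiffOn_gammaBar_Ioo (α : ℝ) : ContDiffOn ℝ ∞ (gammaBar α) (Ioo 0 (π / 2)) := by
  unfold gammaBar
  exact (contDiffOn_angularWeight_Ioo α).sub (by fun_prop)

/-! ### The primitives gain one derivative -/

/-- `(0, π/2) ⊆ (−π/2, π/2)`. [folklore] -/
private theorem Ioo_subset_Ioo' : Ioo (0:ℝ) (π / 2) ⊆ Ioo (-(π / 2)) (π / 2) := fun θ hθ => ⟨by linarith [hθ.1, Real.pi_pos], hθ.2⟩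

/-- `I₁(h) ∈ C^{n+1}(0, π/2)` for `h ∈ C^n(0, π/2)` continuous on `[0, π/2]`. [folklore] -/
theorem contDiffOn_greenI1 {h : ℝ → ℝ} (hc : ContinuousOn h (Icc 0 (π / 2))) {n : ℕ} (hh : ContDiffOn ℝ n h (Ioo 0 (π / 2))) :
    ContDiffOn ℝ (n + 1) (greenI1 h) (Ioo 0 (π / 2)) := by
  have h1 : ContDiffOn ℝ ((n : WithTop ℕ∞) + 1) (greenI1 h) (Ioo 0 (π / 2)) := by
    rw [contDiffOn_succ_iff_deriv_of_isOpen isOpen_Ioo]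
    refine ⟨fun θ hθ => (hasDerivAt_greenI1 hc hθ).differentiableAt.differentiableWithinAt, fun h => by simp at h, ?_⟩
    have hk : ContDiffOn ℝ n (fun θ => greenK2 θ * h θ) (Ioo 0 (π / 2)) :=
      ((contDiffOn_greenK2_Ioo.mono Ioo_subset_Ioo').of_le (by exact_mod_cast le_top)).mul hh
    exact hk.congr fun θ hθ => (hasDerivAt_greenI1 hc hθ).deriv
  exact_mod_cast h1

/-- `I₂(h) ∈ C^{n+1}(0, π/2)` for `h ∈ C^n(0, π/2)` continuous on `[0, π/2]`. [folklore] -/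
theorem contDiffOn_greenI2 {h : ℝ → ℝ} (hc : ContinuousOn h (Icc 0 (π / 2))) {n : ℕ} (hh : ContDiffOn ℝ n h (Ioo 0 (π / 2))) :
    ContDiffOn ℝ (n + 1) (greenI2 h) (Ioo 0 (π / 2)) := by
  have h1 : ContDiffOn ℝ ((n : WithTop ℕ∞) + 1) (greenI2 h) (Ioo 0 (π / 2)) := by
    rw [contDiffOn_succ_iff_deriv_of_isOpen isOpen_Ioo]
    refine ⟨fun θ hθ => (hasDerivAt_greenI2 hc hθ).differentiableAt.differentiableWithinAt, fun h => by simp at h, ?_⟩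
    have hk : ContDiffOn ℝ n (fun θ => -(Real.sin θ * Real.cos θ ^ 2 * h θ)) (Ioo 0 (π / 2)) :=
      ((by fun_prop : ContDiffOn ℝ n (fun θ => Real.sin θ * Real.cos θ ^ 2) _).mul hh).neg
    exact hk.congr fun θ hθ => (hasDerivAt_greenI2 hc hθ).deriv
  exact_mod_cast h1

section smooth

variable {α : ℝ} (hα : 0 < α) (hα' : α ≤ 1 / 200)
include hα hα'

/-! ### The bootstrap -/

/-- `χ₁ ∈ Cⁿ(0, π/2)` for every `n`. [folklore] -/
theorem contDiffOn_chiOne_nat (n : ℕ) : ContDiffOn ℝ n (chiOne α) (Ioo 0 (π / 2)) := by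
  induction n with
  | zero => exact_mod_cast (contDiffOn_zero.2 (chiOne α).continuous.continuousOn)
  | succ n ih =>
    set d := corrData α (chiOne α) with hd
    have hdc : ContinuousOn d (Icc 0 (π / 2)) := (continuous_corrData hα.le (chiOne α)).continuousOn
    have hdn : ContDiffOn ℝ n d (Ioo 0 (π / 2)) := by
      have h1 : ContDiffOn ℝ n (gammaBar α) (Ioo 0 (π / 2)) := (contDiffOn_gammaBar_Ioo α).of_le (by exact_mod_cast le_top)
      have h2 : ContDiffOn ℝ n (fun β => muOne α * Real.cos β * chiOne α β) (Ioo 0 (π / 2)) :=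
        (by fun_prop : ContDiffOn ℝ n (fun β => muOne α * Real.cos β) _).mul ih
      exact (h1.sub h2).congr fun β _ => by simp only [hd, corrData]
    have hI1 : ContDiffOn ℝ n (greenI1 d) (Ioo 0 (π / 2)) := (contDiffOn_greenI1 hdc hdn).of_le (by exact_mod_cast Nat.le_succ n)
    have hI2 : ContDiffOn ℝ n (greenI2 d) (Ioo 0 (π / 2)) := (contDiffOn_greenI2 hdc hdn).of_le (by exact_mod_cast Nat.le_succ n)
    have hv : ContDiffOn ℝ n (fun θ => greenV2 θ / Real.cos θ ^ 3) (Ioo 0 (π / 2)) :=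
      ((contDiffOn_greenV2_Ioo.mono Ioo_subset_Ioo').of_le (by exact_mod_cast le_top)).div (by fun_prop)
        fun θ hθ => pow_ne_zero 3 (Real.cos_pos_of_mem_Ioo (Ioo_subset_Ioo' hθ)).ne'
    have hD : ContDiffOn ℝ n (chiOneD α) (Ioo 0 (π / 2)) := by
      have h := (((by fun_prop : ContDiffOn ℝ n (fun θ => Real.cos θ) _).mul hI1).add (hv.mul hI2)).sub
        (by fun_prop : ContDiffOn ℝ n (fun θ => projCoeff (greenOp d) * Real.cos θ) _)
      exact h.congr fun θ _ => by simp only [chiOneD, hd]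
    have h1 : ContDiffOn ℝ ((n : WithTop ℕ∞) + 1) (chiOne α) (Ioo 0 (π / 2)) := by
      rw [contDiffOn_succ_iff_deriv_of_isOpen isOpen_Ioo]
      refine ⟨fun θ hθ => (hasDerivAt_chiOne hα hα' hθ).differentiableAt.differentiableWithinAt, fun h => by simp at h, ?_⟩
      exact hD.congr fun θ hθ => deriv_chiOne hα hα' hθ
    exact_mod_cast h1

/-- **`χ₁ ∈ C^∞(0, π/2)`.** [cite: Elgindi2021, §8.3 proof of Proposition 8.13 (p. 27 of arXiv:1904.04795): "Clearly Φ̃ is infinitely differentiable away from θ = 0 and θ = π/2"] -/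
theorem contDiffOn_chiOne : ContDiffOn ℝ ∞ (chiOne α) (Ioo 0 (π / 2)) :=
  contDiffOn_infty.2 (contDiffOn_chiOne_nat hα hα')

/-- `χ₁′ ∈ C^∞(0, π/2)`. [folklore] -/
theorem contDiffOn_chiOneD : ContDiffOn ℝ ∞ (chiOneD α) (Ioo 0 (π / 2)) := by
  have h := ((contDiffOn_infty_iff_deriv_of_isOpen isOpen_Ioo).1 (contDiffOn_chiOne hα hα')).2
  exact h.congr fun θ hθ => (deriv_chiOne hα hα' hθ).symm

/-- **`ψ₁ ∈ C^∞(0, π/2)`.** [cite: Elgindi2021, §8.3 proof of Proposition 8.13 (p. 27 of arXiv:1904.04795)] -/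
theorem contDiffOn_psiOne : ContDiffOn ℝ ∞ (psiOne α) (Ioo 0 (π / 2)) := by
  have h := (by fun_prop : ContDiffOn ℝ ∞ (fun θ => Real.cos θ) (Ioo 0 (π / 2))).mul (contDiffOn_chiOne hα hα')
  exact h.congr fun θ _ => rfl

/-- `ψ₁′ ∈ C^∞(0, π/2)`. [folklore] -/
theorem contDiffOn_psiOneD : ContDiffOn ℝ ∞ (psiOneD α) (Ioo 0 (π / 2)) := by
  have h := ((by fun_prop : ContDiffOn ℝ ∞ (fun θ => -Real.sin θ) (Ioo 0 (π / 2))).mul (contDiffOn_chiOne hα hα')).add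
    ((by fun_prop : ContDiffOn ℝ ∞ (fun θ => Real.cos θ) (Ioo 0 (π / 2))).mul (contDiffOn_chiOneD hα hα'))
  exact h.congr fun θ _ => rfl

/-- `deriv ψ₁ = ψ₁′` and `deriv ψ₁′ = ψ₁″` in the open quarter. [folklore] -/
theorem deriv_psiOne {θ : ℝ} (hθ : θ ∈ Ioo 0 (π / 2)) : deriv (psiOne α) θ = psiOneD α θ :=
  (hasDerivAt_psiOne hα hα' hθ).deriv

/-- `deriv ψ₁′ = ψ₁″` in the open quarter. [folklore] -/
theorem deriv_psiOneD {θ : ℝ} (hθ : θ ∈ Ioo 0 (π / 2)) : deriv (psiOneD α) θ = psiOneDD α θ :=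
  (hasDerivAt_psiOneD hα hα' hθ).deriv

/-! ### The vanishing at `θ = 0` -/

/-- **`|χ₁(θ)| ≤ 300θ`** on `[0, π/2]` (mean value theorem on `[ε, θ]`, `ε → 0⁺`, `χ₁(0) = 0`). [folklore] -/
theorem abs_chiOne_le_mul {θ : ℝ} (hθ : θ ∈ Icc 0 (π / 2)) : |chiOne α θ| ≤ 300 * θ := by
  rcases eq_or_lt_of_le hθ.1 with heq | hpos
  · rw [← heq, chiOne_zero hα hα']; simp
  rcases eq_or_lt_of_le hθ.2 with htop | hlt
  · have h := abs_chiOne_le hα hα' θ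
    have : (1:ℝ) ≤ θ := by rw [htop]; have := Real.pi_gt_three; linarith
    nlinarith
  -- `θ ∈ (0, π/2)`: MVT on `[ε, θ]`
  have hθo : θ ∈ Ioo 0 (π / 2) := ⟨hpos, hlt⟩
  have hmvt : ∀ ε ∈ Ioo 0 θ, |chiOne α θ - chiOne α ε| ≤ 300 * (θ - ε) := by
    intro ε hε
    have hsub : Icc ε θ ⊆ Ioo 0 (π / 2) := fun x hx => ⟨hε.1.trans_le hx.1, hx.2.trans_lt hlt⟩
    have h := Convex.norm_image_sub_le_of_norm_hasDerivWithin_le (f := fun x => chiOne α x) (f' := fun x => chiOneD α x) (s := Icc ε θ)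
      (fun x hx => (hasDerivAt_chiOne hα hα' (hsub hx)).hasDerivWithinAt)
      (fun x hx => by rw [Real.norm_eq_abs]; exact abs_chiOneD_le hα hα' (hsub hx))
      (convex_Icc ε θ) (left_mem_Icc.2 hε.2.le) (right_mem_Icc.2 hε.2.le)
    rw [Real.norm_eq_abs, Real.norm_eq_abs, abs_of_nonneg (show (0:ℝ) ≤ θ - ε by linarith [hε.2])] at h
    exact h
  -- let `ε → 0⁺`
  have hcont : Tendsto (fun ε => |chiOne α θ - chiOne α ε|) (𝓝[Ioo 0 θ] 0) (𝓝 |chiOne α θ - chiOne α 0|) := by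
    have : Continuous fun ε => |chiOne α θ - chiOne α ε| := (continuous_const.sub (chiOne α).continuous).abs
    exact (this.tendsto 0).mono_left nhdsWithin_le_nhds
  rw [chiOne_zero hα hα', sub_zero] at hcont
  have hbound : Tendsto (fun ε : ℝ => 300 * (θ - ε)) (𝓝[Ioo 0 θ] 0) (𝓝 (300 * (θ - 0))) :=
    ((continuous_const.mul (continuous_const.sub continuous_id)).tendsto 0).mono_left nhdsWithin_le_nhds
  rw [sub_zero] at hbound
  haveI : (𝓝[Ioo 0 θ] (0:ℝ)).NeBot := by
    rw [← mem_closure_iff_nhdsWithin_neBot, closure_Ioo hpos.ne]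
    exact left_mem_Icc.2 hpos.le
  exact le_of_tendsto_of_tendsto hcont hbound (eventually_nhdsWithin_of_forall hmvt)

/-- **`|χ₁/sin θ| ≤ 480`** on `(0, π/2)` (Jordan: `θ ≤ (π/2) sin θ`). [folklore] -/
theorem abs_chiOne_div_sin_le {θ : ℝ} (hθ : θ ∈ Ioo 0 (π / 2)) : |chiOne α θ / Real.sin θ| ≤ 480 := by
  have hs : 0 < Real.sin θ := Real.sin_pos_of_pos_of_lt_pi hθ.1 (by linarith [hθ.2, Real.pi_pos])
  have h1 := abs_chiOne_le_mul hα hα' (Ioo_subset_Icc_self hθ)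
  have hJ : 2 / π * θ ≤ Real.sin θ := Real.mul_le_sin hθ.1.le hθ.2.le
  have hπ3 := Real.pi_gt_three
  have hπ4 : π ≤ 3.2 := by have := Real.pi_lt_d2; linarith
  rw [abs_div, abs_of_pos hs, div_le_iff₀ hs]
  have : θ ≤ π / 2 * Real.sin θ := by
    rw [div_mul_eq_mul_div, le_div_iff₀ (by positivity : (0:ℝ) < 2)]
    have := mul_le_mul_of_nonneg_left hJ (by positivity : (0:ℝ) ≤ π)
    calc θ * 2 = π * (2 / π * θ) := by field_simp
      _ ≤ π * Real.sin θ := this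
  nlinarith [hs]

/-- **`|ψ₁| ≤ 240 sin 2θ`** on `(0, π/2)`: the corrector vanishes to first order at both ends. [folklore] -/
theorem abs_psiOne_le_sin_two_mul {θ : ℝ} (hθ : θ ∈ Ioo 0 (π / 2)) : |psiOne α θ| ≤ 240 * Real.sin (2 * θ) := by
  have hs : 0 < Real.sin θ := Real.sin_pos_of_pos_of_lt_pi hθ.1 (by linarith [hθ.2, Real.pi_pos])
  have hc : 0 < Real.cos θ := Real.cos_pos_of_mem_Ioo ⟨by linarith [hθ.1, Real.pi_pos], hθ.2⟩
  have h := abs_chiOne_div_sin_le hα hα' hθ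
  rw [abs_div, abs_of_pos hs, div_le_iff₀ hs] at h
  unfold psiOne
  rw [abs_mul, abs_of_pos hc, Real.sin_two_mul]
  nlinarith [mul_pos hs hc]

end smooth

end Elgindi

end Literature.Analysis.FluidPDE
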